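import Summits.Schanuel.Schanuel.Theorems.RootDecomp1KHyper51

/-!
# RootDecomp1KHyper — lens 6, generation 16/17 «ALGEBRAIC-LATTICE-ANCHORED CELL» (AlgLatAnchor.lean edition 2 42f80a0c…, 1588 l) — continuation (RootDecomp1KHyper52): §I the cyclotomic member `z8 = (1, ζ₈, y_C(ζ₈))` (relative degree 4; `placement_z8 (hLW)`); §J summary: the residual of record evaluated at the members

(lens-6 g16/g17 `AlgLatAnchor.lean` edition 2, sha256 42f80a0c…8416, own farm rc 0 · 0 sorry · axioms std; critic VERDICT STATUS L1677 / L1713 PORT GO LOW;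
port by census-1 gen 15 in six parts `RootDecomp1KHyper47`–`52` — see the PORT NOTE of part 47; `--supports stmt-Schanuel-33363`; rung 0.)
-/

open Complex IntermediateField Polynomial

namespace Summit.Schanuel.Schanuel.Theorems.RootDecomp1KHyper

namespace HyperCell

namespace LatCell

variable {n : ℕ}
open Summit.Schanuel.Schanuel.Theorems.RootDecomp1KGeneric (HasHLPairInSpan Rank3SpanResidual
  mem_adjoin_of_mem_span cexp_mem_adjoin_of_mem_span)

/-! ## §I  A member in relative degree 4: the cyclotomic triple `z_8 = (1, ζ₈, y_C(ζ₈))`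

The cell is not a degree-2 phenomenon: `ζ₈ = e^{iπ/4}` (minimal polynomial `T⁴ + 1`), and the same
certificates hold — the `E`-cell one through the degree-4 relation `(N e^{α} − u₀ − u₂ y)⁴ + u₁⁴ = 0`. -/

/-- `ζ₈ = e^{iπ/4}`. -/
noncomputable def ζ8 : ℂ := cexp (((Real.pi / 4 : ℝ) : ℂ) * I)

/-- `‖ζ₈‖ = 1`. -/
theorem norm_ζ8 : ‖ζ8‖ = 1 := Complex.norm_exp_ofReal_mul_I _

/-- `Im ζ₈ = √2/2`. -/
theorem ζ8_im : ζ8.im = Real.sin (Real.pi / 4) := Complex.exp_ofReal_mul_I_im _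

/-- `Im ζ₈ ≠ 0`. -/
theorem ζ8_im_ne_zero : ζ8.im ≠ 0 := by
  rw [ζ8_im]
  exact (Real.sin_pos_of_pos_of_lt_pi (by positivity) (by linarith [Real.pi_pos])).ne'

/-- `ζ₈⁴ = −1`. -/
theorem ζ8_pow_four : ζ8 ^ 4 = -1 := by
  rw [ζ8, ← Complex.exp_nat_mul, ← Complex.exp_pi_mul_I]
  congr 1
  push_cast
  ring

/-- `ζ₈` is an algebraic integer (root of `T⁴ + 1`). -/
theorem isIntegral_ζ8 : IsIntegral ℤ ζ8 := by
  refine ⟨Polynomial.X ^ 4 + Polynomial.C 1, Polynomial.monic_X_pow_add_C 1 (by norm_num), ?_⟩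
  simp [Polynomial.eval₂_add, Polynomial.eval₂_X_pow, ζ8_pow_four]

/-- `ζ₈` is algebraic. -/
theorem isAlgebraic_ζ8 : IsAlgebraic ℚ ζ8 :=
  (IsFractionRing.isAlgebraic_iff ℤ ℚ ℂ).mp isIntegral_ζ8.isAlgebraic

/-- **The cyclotomic member** `z_8 = (1, ζ₈, y_C(ζ₈))`. -/
noncomputable def z8 : Fin 3 → ℂ := latTriple 1 ζ8 (yC ζ8)

/-- Literal read-out of `z_8 = (1, ζ₈, y_C(ζ₈))`. -/
theorem z8_def : z8 = latTriple 1 ζ8 (yC ζ8) := rfl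

/-- `y_C(ζ₈)` is hyper-approximable from the lattice `ℤ + ℤζ₈`. -/
theorem hyperLatApprox_yC_ζ8 : HyperLatApprox 1 ζ8 (yC ζ8) :=
  hyperLatApprox_yC norm_ζ8.le ζ8_im_ne_zero

/-- `z_8` is ℚ-linearly independent. -/
theorem linearIndependent_z8 : LinearIndependent ℚ z8 := linearIndependent_latTriple_yC ζ8_im_ne_zero

/-- `z_8` has hyper-small linear forms. -/
theorem hyperLinLiouville_z8 : HyperLinLiouville z8 := hyperLinLiouville_latTriple hyperLatApprox_yC_ζ8

/-- The small forms of `z_8` are genuinely ternary. -/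
theorem ternarySmallForms_z8 (m : ℕ) : ∃ h : Fin 3 → ℤ, (∀ i, h i ≠ 0) ∧
    ‖∑ i, (h i : ℂ) * z8 i‖ < Real.exp (-((1 + ∑ i, |(h i : ℝ)|) ^ m)) :=
  ternarySmallForms_yC norm_ζ8.le ζ8_im_ne_zero m

/-- `z_8` has no HL pair in its span. -/
theorem not_hasHLPairInSpan_z8 : ¬ HasHLPairInSpan z8 := not_hasHLPairInSpan_latTriple_yC ζ8_im_ne_zero

/-- `z_8` has an algebraic lattice anchor (`1`, `ζ₈`). -/
theorem hasAlgLatAnchor_z8 : HasAlgLatAnchor z8 :=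
  hasAlgLatAnchor_latTriple_yC isAlgebraic_ζ8 ζ8_im_ne_zero

/-- `z_8` has no real quadratic anchor. -/
theorem not_hasRealQuadAnchor_z8 : ¬ HasRealQuadAnchor z8 :=
  not_hasRealQuadAnchor_latTriple_yC ζ8_im_ne_zero

/-- `z_8` has no Nesterenko lattice anchor. -/
theorem not_hasPiLatAnchor_z8 : ¬ HasPiLatAnchor z8 := not_hasPiLatAnchor_latTriple_yC ζ8_im_ne_zero

/-- `z_8` has no Nesterenko integer anchor. -/
theorem not_hasPiIntAnchor_z8 : ¬ HasPiIntAnchor z8 := not_hasPiIntAnchor_latTriple_yC ζ8_im_ne_zero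

set_option maxHeartbeats 800000 in
/-- **Key non-membership for `z_8` (mod LW)**, through the degree-4 relation
`(N e^{α} − u₀ − u₂ y)⁴ + u₁⁴ = 0` (`(u₁ζ₈)⁴ = −u₁⁴`) and the resultant engine with `ω = ζ₈`. -/
theorem int_mul_cexp_not_mem_span_z8 (hLW : LWMeasure) {α : ℂ} (hα : IsAlgebraic ℚ α) (hα0 : α ≠ 0)
    {N : ℤ} (hN : N ≠ 0) : (N : ℂ) * cexp α ∉ Submodule.span ℤ (Set.range z8) := by
  intro hmem
  obtain ⟨u, hu⟩ := (Submodule.mem_span_range_iff_exists_fun ℤ).mp hmem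
  have hu' : (u 0 : ℂ) + (u 1 : ℂ) * ζ8 + (u 2 : ℂ) * yC ζ8 = (N : ℂ) * cexp α := by
    rw [← hu, Fin.sum_univ_three]
    simp [z8, zsmul_eq_mul, mul_comm]
  have hθ := mvWeakMeasure_cexp_single hLW hα hα0
  set P : MvPolynomial (Fin 1) ℤ := MvPolynomial.C N * MvPolynomial.X 0 - MvPolynomial.C (u 0)
    with hP
  set G : Fin 5 → MvPolynomial (Fin 1) ℤ :=
    ![P ^ 4 + MvPolynomial.C (u 1 ^ 4), MvPolynomial.C (-4 * u 2) * P ^ 3,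
      MvPolynomial.C (6 * u 2 ^ 2) * P ^ 2, MvPolynomial.C (-4 * u 2 ^ 3) * P,
      MvPolynomial.C (u 2 ^ 4)] with hG
  have hG0 : G 0 ≠ 0 := by
    intro h0
    have h0' : P ^ 4 + MvPolynomial.C (u 1 ^ 4) = 0 := by simpa [hG] using h0
    have hev : ∀ t : ℤ, (N * t - u 0) ^ 4 + u 1 ^ 4 = 0 := by
      intro t
      have := congr_arg (MvPolynomial.eval fun _ : Fin 1 => t) h0'
      simpa [hP] using this
    have e0 := hev 0
    have e1 := hev 1
    ring_nf at e0
    have hu0' : u 0 ^ 4 = 0 := by nlinarith [sq_nonneg (u 0 ^ 2), sq_nonneg (u 1 ^ 2)]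
    have hu1' : u 1 ^ 4 = 0 := by nlinarith [sq_nonneg (u 0 ^ 2), sq_nonneg (u 1 ^ 2)]
    have hu0 : u 0 = 0 := pow_eq_zero_iff (by norm_num) |>.mp hu0'
    have hu1 : u 1 = 0 := pow_eq_zero_iff (by norm_num) |>.mp hu1'
    rw [hu0, hu1] at e1
    ring_nf at e1
    have : N ^ 4 = 0 := by linarith
    exact hN (pow_eq_zero_iff (by norm_num) |>.mp this)
  refine no_int_relation_of_mvWeakMeasure_hyperAlgLat hθ isIntegral_ζ8 hyperLatApprox_yC_ζ8 G
    ⟨0, hG0⟩ ?_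
  rw [Fin.sum_univ_five]
  simp only [hG, hP, Matrix.cons_val_zero, Matrix.cons_val_one, Matrix.cons_val_two,
    Matrix.cons_val, Matrix.head_cons, Matrix.tail_cons, map_add, map_sub, map_mul, map_pow,
    map_neg, MvPolynomial.aeval_C, MvPolynomial.aeval_X]
  simp only [algebraMap_int_eq, eq_intCast, Int.cast_ofNat, Fin.val_zero, Fin.val_one, Fin.val_two,
    pow_zero, pow_one, mul_one]
  norm_num
  linear_combination
    (-4 * ((u 1 : ℂ) * ζ8) ^ 3 +
          6 * ((u 1 : ℂ) * ζ8) ^ 2 * ((u 0 : ℂ) + (u 1 : ℂ) * ζ8 + (u 2 : ℂ) * yC ζ8 - (N : ℂ) * cexp α) -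
          4 * ((u 1 : ℂ) * ζ8) * ((u 0 : ℂ) + (u 1 : ℂ) * ζ8 + (u 2 : ℂ) * yC ζ8 - (N : ℂ) * cexp α) ^ 2 +
          ((u 0 : ℂ) + (u 1 : ℂ) * ζ8 + (u 2 : ℂ) * yC ζ8 - (N : ℂ) * cexp α) ^ 3) * hu' +
      (u 1 : ℂ) ^ 4 * ζ8_pow_four

/-- **`¬HasExpLatAnchor z_8` (mod LW)**. -/
theorem not_hasExpLatAnchor_z8 (hLW : LWMeasure) : ¬ HasExpLatAnchor z8 := by
  rintro (⟨α, N₁, N₂, hα, hirr, -, hN₂, -, hm₂⟩ | ⟨α, N₁, N₂, hα, hli, hN₁, -, hm₁, -⟩)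
  · exact int_mul_cexp_not_mem_span_z8 hLW hα (fun h => hirr 0 (by rw [h]; simp)) hN₂ hm₂
  · exact int_mul_cexp_not_mem_span_z8 hLW (hα 0) (by simpa using hli.ne_zero 0) hN₁
      (by simpa using hm₁)

/-- **`z_8` is decided by the new cell (mod LW)**. -/
theorem sb_three_z8 (hLW : LWMeasure) : SB 3 z8 :=
  sb_three_of_algLatAnchor hLW linearIndependent_z8 hyperLinLiouville_z8 hasAlgLatAnchor_z8

/-- **PLACEMENT of `z_8`** (inside `UnanchoredResidual₃‴`'s domain, decided by the new cell). -/
theorem placement_z8 (hLW : LWMeasure) :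
    LinearIndependent ℚ z8 ∧ HyperLinLiouville z8 ∧ ¬ HasHLPairInSpan z8 ∧ ¬ HasRealQuadAnchor z8 ∧
      ¬ HasExpLatAnchor z8 ∧ ¬ HasPiLatAnchor z8 ∧ HasAlgLatAnchor z8 ∧ SB 3 z8 :=
  ⟨linearIndependent_z8, hyperLinLiouville_z8, not_hasHLPairInSpan_z8, not_hasRealQuadAnchor_z8,
    not_hasExpLatAnchor_z8 hLW, not_hasPiLatAnchor_z8, hasAlgLatAnchor_z8, sb_three_z8 hLW⟩

/-! ## §J  Summary: the residual of record evaluated at the members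

`UnanchoredResidual₃‴` (the residual of record, critic VERDICT L1617/L1634) does NOT decide `z_G`
by exclusion — `z_G` satisfies all six of its hypotheses — so a proof of it must PRODUCE `SB 3 z_G`;
the new cell produces it, and the new residual `UnanchoredResidual₄` excludes `z_G`. -/

/-- `z_G` is in the DOMAIN of the residual of record: every hypothesis holds (mod LW for `¬ExpLat`). -/
theorem zG_in_domain_of_unanchoredResidual₃ (hLW : LWMeasure)
    (hR : ∀ z : Fin 3 → ℂ, LinearIndependent ℚ z → HyperLinLiouville z → ¬ HasHLPairInSpan z →
        ¬ HasRealQuadAnchor z → ¬ HasExpLatAnchor z → ¬ HasPiLatAnchor z → SB 3 z) : SB 3 zG :=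
  hR zG linearIndependent_zG hyperLinLiouville_zG not_hasHLPairInSpan_zG not_hasRealQuadAnchor_zG
    (not_hasExpLatAnchor_zG hLW) not_hasPiLatAnchor_zG

/-- `z_8` likewise. -/
theorem z8_in_domain_of_unanchoredResidual₃ (hLW : LWMeasure)
    (hR : ∀ z : Fin 3 → ℂ, LinearIndependent ℚ z → HyperLinLiouville z → ¬ HasHLPairInSpan z →
        ¬ HasRealQuadAnchor z → ¬ HasExpLatAnchor z → ¬ HasPiLatAnchor z → SB 3 z) : SB 3 z8 :=
  hR z8 linearIndependent_z8 hyperLinLiouville_z8 not_hasHLPairInSpan_z8 not_hasRealQuadAnchor_z8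
    (not_hasExpLatAnchor_z8 hLW) not_hasPiLatAnchor_z8

/-- The LIVE item `HyperLiouvilleSchanuel` (33363) evaluated at `z_G`: it asserts exactly `SB 3 z_G`
(the member is in the item's scope: ℚ-free with hyper-small integer forms). -/
theorem hyperLiouvilleSchanuel_at_zG
    (h33363 : ∀ (n : ℕ) (z : Fin n → ℂ), LinearIndependent ℚ z →
      (∀ m : ℕ, ∃ h : Fin n → ℤ, h ≠ 0 ∧ ‖∑ i, (h i : ℂ) * z i‖ <
          Real.exp (-((1 + ∑ i, (|h i| : ℝ)) ^ m))) →
      (n : Cardinal) ≤ Algebra.trdeg ℚ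
        ↥(IntermediateField.adjoin ℚ (Set.range z ∪ Set.range (Complex.exp ∘ z)))) :
    SB 3 zG :=
  h33363 3 zG linearIndependent_zG hyperLinLiouville_zG

end LatCell

end HyperCell

end Summit.Schanuel.Schanuel.Theorems.RootDecomp1KHyper
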